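import Literature.AlgebraicGeometry.Resolution.CartierDivisorControlledTransform
import Literature.AlgebraicGeometry.Resolution.MarkedIdealsArithmetic
import Literature.AlgebraicGeometry.Resolution.MonomialMarkedIdeals
import Literature.AlgebraicGeometry.Hironaka2017.Lib.MonomialPartBlowup
import Summits.ResolutionOfSingularities.ResolutionOfSingularities.Theorems.FrobeniusClosingPatchingRelPerfectDepthMixedFormatB
import HarnessLib

/-!
# Crux `PatchingRelPerfect` (stmt-ResolutionOfSingularities-16161), chain W5.2 — F5c (= F7(α), target T5-E^nr
# `WeightTwoBoundaryJRnr₃`): the HOST LAW of a FACTORISED host under one blowing up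

[OURS · L1 W5.2 · F5c brick «host law» (res-L1-w52-plan-1 STEER 4, 2026-08-27T11:07:07Z (3))] Replaces the role of NO
printed item; NOT a statement of the manuscript under review; fact-free (no named-fact hypothesis).

The E-side transport of T5-E^nr (owner res-D-pv-052) carries the host of the weighted state FACTORISED:
`D = monomialIdeal Ps = ∏_k P_k^{e_k}` with `Ps = [(P_k, e_k)]` a list of effective Cartier divisors (the prime components
of the host) with exponents — instead of T5-E's reduced host (`WeightTwoB.StateIn.hostRad`). Blowing up a regular
irreducible centre `V(C)` (generic point `η`) of the regular ambient scheme `W` by `τ : W′ → W`, with `m_k := ord_η P_k`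
the generic order of the `k`-th factor along the centre, the host is transported with the weight
`m := Σ_k e_k · m_k` and STAYS FACTORISED:

* §1 (pure blow-up algebra, any `τ` with `C𝒪_{W′}` effective Cartier, any weights `m_k` with `P_k ≤ C^{m_k}`):
  `monomialIdeal_le_pow_sum` — `∏ P_k^{e_k} ≤ C^{Σ e_k m_k}`;
  **`controlledTransform_monomialIdeal`** — `τᶜ(∏ P_k^{e_k}, Σ e_k m_k) = ∏ τᶜ(P_k, m_k)^{e_k}` (multiplicativity of the
  controlled transform, tree `controlledTransform_mul` / `controlledTransform_pow`, BGMW Lemma 3.7.1).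
* §2 (orders at a point with regular local ring): **`idealOrder_monomialIdeal_eq_sum`** — `ord_x(∏ P_k^{e_k}) = Σ e_k · ord_x P_k`
  for effective Cartier `P_k` (the order of a regular local ring is a valuation, Zariski–Samuel VIII §1 Thm. 1; tree
  `idealOrder_mul_of_span_singleton`, `pow_not_mem_pow_of_not_mem_pow`). So `m = Σ e_k m_k` IS the exact generic order of
  the host along the centre.
* §3 (`W` regular locally Noetherian, `V(C)` regular irreducible nowhere dense with generic point `η`, `τ` a blowing up
  along `C`, `m_k = ord_η P_k`): **`controlledTransform_monomialIdeal_eq_map_strictTransform`** —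
  `τᶜ(monomialIdeal Ps, Σ e_k m_k) = monomialIdeal (Ps.map (st, e))`, `st = strictTransformIdeal τ C` (per factor the strict
  transform IS the controlled transform with the generic weight, tree `IsBlowup.strictTransformIdeal_eq_controlledTransform`,
  Kollár 3.30.2); the comap form `τ^*(monomialIdeal Ps) = (C𝒪)^{Σ e_k m_k} · monomialIdeal (Ps.map (st, e))`
  (`comap_monomialIdeal_eq_pow_mul`); the strict transform of the whole host
  `strictTransformIdeal τ C (monomialIdeal Ps) = monomialIdeal (Ps.map (st, e))`; «NO EXCEPTIONAL COMPONENT»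
  `¬ monomialIdeal (Ps.map (st, e)) ≤ C𝒪` (`not_monomialIdeal_map_strictTransform_le_comap`); the transported factors are
  effective Cartier (`isEffectiveCartier_strictTransformIdeal`), hence so is the transported host; and the same law with
  the weights READ OFF as `(ord_η P_k).toNat` (`controlledTransform_monomialIdeal_eq_map_strictTransform_toNat`) and in the
  PIECE dress `C = 𝓘(Z)`, `IsGenericPoint η Z` of `WeightTwoB.CentreIn` (`…_piece`).

AI-written; AI review is weaker than expert review.

## References
* E. Bierstone, D. Grigoriev, P. Milman, J. Włodarczyk, arXiv:1206.3090, §3.2 Lemma 3.2.1, Lemma 3.7.1.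
  [BierstoneGrigorievMilmanWlodarczyk2011]
* J. Kollár, *Lectures on Resolution of Singularities* (2007), 3.30.2, (3.111) Step 3. [Kollar2007]
* O. Zariski, P. Samuel, *Commutative Algebra* II (1960), Ch. VIII §1 Thm. 1. [ZariskiSamuel1960]
-/

-- `Summit.<Summit>.<Sub>.Theorems` with `Sub = Summit` (single-conjunct summit, D-0017)
set_option linter.dupNamespace false

noncomputable section

open CategoryTheory CategoryTheory.Limits AlgebraicGeometry TopologicalSpace IsLocalRing
open Literature.AlgebraicGeometry.Resolution Scheme.IdealSheafData
open Literature.AlgebraicGeometry.Hironaka2017.MonomialPart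

namespace Summit.ResolutionOfSingularities.ResolutionOfSingularities.Theorems

universe u

namespace DepthHostLaw

variable {W W' : Scheme.{u}} {τ : W' ⟶ W} {C : W.IdealSheafData}

/-! ## §1 Pure blow-up algebra: the controlled transform of a monomial in ideals `≤ C^{m_k}` -/

/-- **`∏ P_k^{e_k} ≤ C^{Σ e_k m_k}`** when `P_k ≤ C^{m_k}` for every factor. [folklore] -/
theorem monomialIdeal_le_pow_sum (Ps : List (W.IdealSheafData × ℕ)) (m : W.IdealSheafData → ℕ)
    (hle : ∀ P ∈ boundaryOf Ps, P ≤ C ^ m P) :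
    monomialIdeal Ps ≤ C ^ (Ps.map fun p => p.2 * m p.1).sum := by
  induction Ps with
  | nil => rw [monomialIdeal_nil, List.map_nil, List.sum_nil, pow_zero, Scheme.IdealSheafData.one_eq_top]
  | cons p Ps ih =>
    rw [monomialIdeal_cons, List.map_cons, List.sum_cons, pow_add]
    refine mul_le_mul' ?_ (ih fun P hP => hle P (List.mem_cons_of_mem _ hP))
    rw [mul_comm p.2, pow_mul]
    exact pow_le_pow_left' (hle p.1 (fst_mem_boundaryOf List.mem_cons_self)) _

/-- **Multiplicativity: `τᶜ(∏ P_k^{e_k}, Σ e_k m_k) = ∏ τᶜ(P_k, m_k)^{e_k}`** for any morphism `τ` whose exceptional ideal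
`C𝒪_{W′}` is an effective Cartier divisor and factors `P_k ≤ C^{m_k}` (BGMW Lemma 3.7.1 «moreover», iterated: tree
`controlledTransform_mul`, `controlledTransform_pow`).
[cite: BierstoneGrigorievMilmanWlodarczyk2011, Lemma 3.7.1] -/
theorem controlledTransform_monomialIdeal [IsLocallyNoetherian W'] (hD : IsEffectiveCartier (C.comap τ))
    (Ps : List (W.IdealSheafData × ℕ)) (m : W.IdealSheafData → ℕ) (hle : ∀ P ∈ boundaryOf Ps, P ≤ C ^ m P) :
    controlledTransform τ C (monomialIdeal Ps) (Ps.map fun p => p.2 * m p.1).sum =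
      monomialIdeal (Ps.map fun p => (controlledTransform τ C p.1 (m p.1), p.2)) := by
  induction Ps with
  | nil =>
    rw [monomialIdeal_nil, List.map_nil, List.sum_nil, controlledTransform_zero, Scheme.IdealSheafData.comap_top,
      List.map_nil, monomialIdeal_nil]
  | cons p Ps ih =>
    have hp : p.1 ≤ C ^ m p.1 := hle p.1 (fst_mem_boundaryOf List.mem_cons_self)
    have hPs : ∀ P ∈ boundaryOf Ps, P ≤ C ^ m P := fun P hP => hle P (List.mem_cons_of_mem _ hP)
    have h1 : p.1.comap τ ≤ C.comap τ ^ m p.1 := comap_le_comap_pow_of_le_pow hp τ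
    have h1' : (p.1 ^ p.2).comap τ ≤ C.comap τ ^ (p.2 * m p.1) := by
      refine comap_le_comap_pow_of_le_pow ?_ τ
      rw [mul_comm p.2, pow_mul]
      exact pow_le_pow_left' hp _
    have h2 : (monomialIdeal Ps).comap τ ≤ C.comap τ ^ (Ps.map fun p => p.2 * m p.1).sum :=
      comap_le_comap_pow_of_le_pow (monomialIdeal_le_pow_sum Ps m hPs) τ
    rw [monomialIdeal_cons, List.map_cons, List.sum_cons, List.map_cons, monomialIdeal_cons,
      controlledTransform_mul hD h1' h2, controlledTransform_pow hD h1 p.2, ih hPs]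

/-- The boundary list of the transported exponent list. [folklore] -/
theorem boundaryOf_map_pair {W₁ : Scheme.{u}} (Ps : List (W.IdealSheafData × ℕ)) (f : W.IdealSheafData → W₁.IdealSheafData) :
    boundaryOf (Ps.map fun p => (f p.1, p.2)) = (boundaryOf Ps).map f := by
  simp [boundaryOf, List.map_map, Function.comp_def]

/-- The exponents of the transported list are the old exponents; in particular its weights against any weight function
factor through `f`. [folklore] -/
theorem map_weight_map_pair {W₁ : Scheme.{u}} (Ps : List (W.IdealSheafData × ℕ))
    (f : W.IdealSheafData → W₁.IdealSheafData) (m₁ : W₁.IdealSheafData → ℕ) :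
    ((Ps.map fun p => (f p.1, p.2)).map fun q => q.2 * m₁ q.1) = Ps.map fun p => p.2 * m₁ (f p.1) := by
  simp [List.map_map, Function.comp_def]

/-! ## §2 Orders at a regular point: the weight `Σ e_k · ord P_k` is the EXACT order of the host -/

/-- **`ord_x(∏ P_k^{e_k}) = Σ_k e_k · ord_x P_k`** at a point `x` with regular local ring, for effective Cartier factors
`P_k` of orders `m_k = ord_x P_k` (the order of a regular local ring is a valuation: tree `idealOrder_mul_of_span_singleton`
for the principal stalks `(g_k^{e_k})`, `pow_not_mem_pow_of_not_mem_pow`). [cite: ZariskiSamuel1960, Ch. VIII §1 Thm. 1] -/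
theorem idealOrder_monomialIdeal_eq_sum {x : W} [IsRegularLocalRing (W.presheaf.stalk x)]
    (Ps : List (W.IdealSheafData × ℕ)) (m : W.IdealSheafData → ℕ) (hcart : ∀ P ∈ boundaryOf Ps, IsEffectiveCartier P)
    (hord : ∀ P ∈ boundaryOf Ps, idealOrder P x = m P) :
    idealOrder (monomialIdeal Ps) x = ((Ps.map fun p => p.2 * m p.1).sum : ℕ) := by
  induction Ps with
  | nil => rw [monomialIdeal_nil, idealOrder_top, List.map_nil, List.sum_nil, Nat.cast_zero]
  | cons p Ps ih =>
    have hpB : p.1 ∈ boundaryOf (p :: Ps) := fst_mem_boundaryOf List.mem_cons_self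
    have hm : idealOrder p.1 x = m p.1 := hord p.1 hpB
    obtain ⟨g, -, hg⟩ := (hcart p.1 hpB).exists_stalkIdeal_eq_span x
    have ih' := ih (fun P hP => hcart P (List.mem_cons_of_mem _ hP)) (fun P hP => hord P (List.mem_cons_of_mem _ hP))
    rw [monomialIdeal_cons, List.map_cons, List.sum_cons]
    refine idealOrder_mul_of_span_singleton (p.1 ^ p.2) (monomialIdeal Ps) (g := g ^ p.2) (w := p.2 * m p.1) ?_ ?_ ?_ ih'
    · rw [stalkIdeal_pow, hg, Ideal.span_singleton_pow]
    · -- `g ∈ 𝔪^{m}` hence `g^e ∈ 𝔪^{e m}`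
      have h1 : stalkIdeal p.1 x ≤ maximalIdeal (W.presheaf.stalk x) ^ m p.1 := by
        rw [← le_idealOrder_iff, hm]
      have hg1 : g ∈ maximalIdeal (W.presheaf.stalk x) ^ m p.1 := h1 (by rw [hg]; exact Ideal.mem_span_singleton_self g)
      rw [mul_comm p.2, pow_mul]
      exact Ideal.pow_mem_pow hg1 _
    · -- `g ∉ 𝔪^{m+1}` hence `g^e ∉ 𝔪^{e m + 1}`
      have h2 : ¬ stalkIdeal p.1 x ≤ maximalIdeal (W.presheaf.stalk x) ^ (m p.1 + 1) := by
        rw [← le_idealOrder_iff, hm]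
        exact_mod_cast Nat.lt_irrefl _ ∘ Nat.lt_of_succ_le
      have hg2 : g ∉ maximalIdeal (W.presheaf.stalk x) ^ (m p.1 + 1) := fun h =>
        h2 (by rw [hg]; exact (Ideal.span_singleton_le_iff_mem _).mpr h)
      exact pow_not_mem_pow_of_not_mem_pow hg2 p.2

/-- The weights read off: with `m_k := (ord_x P_k).toNat` (finite orders), `ord_x(∏ P_k^{e_k}) = Σ e_k m_k`. [folklore] -/
theorem idealOrder_monomialIdeal_eq_sum_toNat {x : W} [IsRegularLocalRing (W.presheaf.stalk x)]
    (Ps : List (W.IdealSheafData × ℕ)) (hcart : ∀ P ∈ boundaryOf Ps, IsEffectiveCartier P)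
    (hfin : ∀ P ∈ boundaryOf Ps, idealOrder P x ≠ ⊤) :
    idealOrder (monomialIdeal Ps) x = ((Ps.map fun p => p.2 * (idealOrder p.1 x).toNat).sum : ℕ) :=
  idealOrder_monomialIdeal_eq_sum Ps (fun P => (idealOrder P x).toNat) hcart fun P hP => (ENat.coe_toNat (hfin P hP)).symm

/-! ### Instance-free companions (generic order = weight; Cartier; finiteness; support) -/

/-- **The generic order of the factorised host is the weight**: `ord_η(∏ P_k^{e_k}) = Σ e_k m_k` (`η` has a regular local
ring). [cite: ZariskiSamuel1960, Ch. VIII §1 Thm. 1] -/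
theorem idealOrder_monomialIdeal_genericPoint {η : W} (hW : Scheme.IsRegular W) (Ps : List (W.IdealSheafData × ℕ))
    (m : W.IdealSheafData → ℕ) (hcart : ∀ P ∈ boundaryOf Ps, IsEffectiveCartier P)
    (hord : ∀ P ∈ boundaryOf Ps, idealOrder P η = m P) :
    idealOrder (monomialIdeal Ps) η = ((Ps.map fun p => p.2 * m p.1).sum : ℕ) := by
  haveI : IsRegularLocalRing (W.presheaf.stalk η) := hW η
  exact idealOrder_monomialIdeal_eq_sum Ps m hcart hord

/-- **The factorised host is an effective Cartier divisor.** [cite: Kollar2007, (3.111) Step 3] -/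
theorem isEffectiveCartier_monomialIdeal {Ps : List (W.IdealSheafData × ℕ)}
    (hcart : ∀ P ∈ boundaryOf Ps, IsEffectiveCartier P) : IsEffectiveCartier (monomialIdeal Ps) :=
  DepthGraded.isEffectiveCartier_monomialIdeal hcart

/-- The generic orders of effective Cartier factors are finite (non-zero principal stalks in a Noetherian local ring;
Krull's intersection theorem) — the `hfin` binder of the `_toNat` forms. [folklore] -/
theorem idealOrder_ne_top_of_isEffectiveCartier {x : W} [IsNoetherianRing (W.presheaf.stalk x)] {P : W.IdealSheafData}
    (hcart : IsEffectiveCartier P) : idealOrder P x ≠ ⊤ := by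
  intro h
  obtain ⟨g, hg0, hg⟩ := hcart.exists_stalkIdeal_eq_span x
  have hne : stalkIdeal P x ≠ ⊥ := by rw [hg]; simpa using nonZeroDivisors.ne_zero hg0
  apply hne
  rw [eq_bot_iff, ← Ideal.iInf_pow_eq_bot_of_isLocalRing (I := maximalIdeal (W.presheaf.stalk x))
    (maximalIdeal.isMaximal _).ne_top]
  refine le_iInf fun r => (le_idealOrder_iff P x r).mp ?_
  rw [h]
  exact le_top

/-- A point of the support of the host lies on some factor with positive exponent. [folklore] -/
theorem exists_mem_support_of_mem_support_monomialIdeal {x : W} {Ps : List (W.IdealSheafData × ℕ)}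
    (hx : x ∈ (monomialIdeal Ps).support) : ∃ p ∈ Ps, 0 < p.2 ∧ x ∈ p.1.support := by
  induction Ps with
  | nil =>
    rw [monomialIdeal_nil, mem_support_iff_stalkIdeal_le, stalkIdeal_top, top_le_iff] at hx
    exact absurd hx (maximalIdeal.isMaximal _).ne_top
  | cons p Ps ih =>
    rw [monomialIdeal_cons, mem_support_iff_stalkIdeal_le, stalkIdeal_mul, stalkIdeal_pow,
      (maximalIdeal.isMaximal _).isPrime.mul_le] at hx
    rcases hx with h | h
    · have hpos : 0 < p.2 := by
        rcases Nat.eq_zero_or_pos p.2 with h0 | h0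
        · rw [h0, pow_zero, Ideal.one_eq_top, top_le_iff] at h
          exact absurd h (maximalIdeal.isMaximal _).ne_top
        · exact h0
      rw [Ideal.IsPrime.pow_le_iff hpos.ne'] at h
      exact ⟨p, List.mem_cons_self, hpos, (mem_support_iff_stalkIdeal_le _ _).mpr h⟩
    · obtain ⟨q, hq, hq'⟩ := ih ((mem_support_iff_stalkIdeal_le _ _).mpr h)
      exact ⟨q, List.mem_cons_of_mem _ hq, hq'⟩

/-! ## §3 Geometry: along a blowing up of a regular irreducible centre of a regular scheme, the factorised host is
transported factor by factor by STRICT transforms -/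

section Blowup

variable [IsLocallyNoetherian W] {η : W}

/-- **`∏ P_k^{e_k} ≤ C^{Σ e_k m_k}`, `m_k = ord_η P_k` the generic orders along the regular centre** (BGMW Lemma 3.2.1 (1)
per factor, tree `le_pow_of_idealOrder_genericPoint_eq`). [cite: BierstoneGrigorievMilmanWlodarczyk2011, Lemma 3.2.1 (1)] -/
theorem monomialIdeal_le_pow_sum_of_idealOrder (hW : Scheme.IsRegular W) (hC : Scheme.IsRegular C.subscheme)
    (hη : IsGenericPoint η (C.support : Set W)) (Ps : List (W.IdealSheafData × ℕ)) (m : W.IdealSheafData → ℕ)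
    (hord : ∀ P ∈ boundaryOf Ps, idealOrder P η = m P) :
    monomialIdeal Ps ≤ C ^ (Ps.map fun p => p.2 * m p.1).sum :=
  monomialIdeal_le_pow_sum Ps m fun P hP => le_pow_of_idealOrder_genericPoint_eq hW hC hη (hord P hP)

/-- [OURS · L1 W5.2 · F5c host law] **THE HOST LAW.** For `W` regular locally Noetherian, `V(C)` a regular irreducible
nowhere dense centre with generic point `η`, `τ : W′ → W` a blowing up along `C`, and a factorised host `∏_k P_k^{e_k}`
(`Ps = [(P_k, e_k)]`, every `P_k` an effective Cartier divisor of generic order `m_k = ord_η P_k` along the centre):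
`τᶜ(∏ P_k^{e_k}, Σ_k e_k m_k) = ∏_k (strictTransformIdeal τ C P_k)^{e_k} = monomialIdeal (Ps.map (st, e))`.
Multiplicativity (§1) + «the strict transform of a divisor is its controlled transform with the generic weight» per factor
(tree `IsBlowup.strictTransformIdeal_eq_controlledTransform`). [cite: Kollar2007, 3.30.2]
[cite: BierstoneGrigorievMilmanWlodarczyk2011, Lemma 3.7.1] -/
theorem controlledTransform_monomialIdeal_eq_map_strictTransform (hW : Scheme.IsRegular W)
    (hC : Scheme.IsRegular C.subscheme) (hη : IsGenericPoint η (C.support : Set W))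
    (hint : interior (C.support : Set W) = ∅) (hτ : IsBlowup τ C) (Ps : List (W.IdealSheafData × ℕ))
    (m : W.IdealSheafData → ℕ) (hcart : ∀ P ∈ boundaryOf Ps, IsEffectiveCartier P)
    (hord : ∀ P ∈ boundaryOf Ps, idealOrder P η = m P) :
    controlledTransform τ C (monomialIdeal Ps) (Ps.map fun p => p.2 * m p.1).sum =
      monomialIdeal (Ps.map fun p => (strictTransformIdeal τ C p.1, p.2)) := by
  haveI : IsLocallyNoetherian W' := hτ.isLocallyNoetherian
  rw [controlledTransform_monomialIdeal hτ.isEffectiveCartier Ps m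
    fun P hP => le_pow_of_idealOrder_genericPoint_eq hW hC hη (hord P hP)]
  congr 1
  refine List.map_congr_left fun p hp => ?_
  have hpB : p.1 ∈ boundaryOf Ps := fst_mem_boundaryOf hp
  rw [hτ.strictTransformIdeal_eq_controlledTransform hW hC hη hint (hord p.1 hpB) (hcart p.1 hpB)]

/-- **Comap form of the host law**: `τ^*(∏ P_k^{e_k}) = (C𝒪_{W′})^{Σ e_k m_k} · ∏ (st P_k)^{e_k}` — the shape
`𝓗.comap τ = (C.comap τ)^m * 𝓗′` consumed by `WeightTwoB.comap_host_mul_monomialIdeal`.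
[cite: BierstoneGrigorievMilmanWlodarczyk2011, §3.2] -/
theorem comap_monomialIdeal_eq_pow_mul (hW : Scheme.IsRegular W) (hC : Scheme.IsRegular C.subscheme)
    (hη : IsGenericPoint η (C.support : Set W)) (hint : interior (C.support : Set W) = ∅) (hτ : IsBlowup τ C)
    (Ps : List (W.IdealSheafData × ℕ)) (m : W.IdealSheafData → ℕ) (hcart : ∀ P ∈ boundaryOf Ps, IsEffectiveCartier P)
    (hord : ∀ P ∈ boundaryOf Ps, idealOrder P η = m P) :
    (monomialIdeal Ps).comap τ =
      C.comap τ ^ (Ps.map fun p => p.2 * m p.1).sum * monomialIdeal (Ps.map fun p => (strictTransformIdeal τ C p.1, p.2)) := by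
  rw [← controlledTransform_monomialIdeal_eq_map_strictTransform hW hC hη hint hτ Ps m hcart hord]
  exact hτ.comap_eq_pow_mul_controlledTransform_of_le_pow (monomialIdeal_le_pow_sum_of_idealOrder hW hC hη Ps m hord)

/-- **The strict transform of the whole host is the product of the strict transforms of its factors**:
`strictTransformIdeal τ C (∏ P_k^{e_k}) = ∏ (strictTransformIdeal τ C P_k)^{e_k}` (the host is an effective Cartier divisor
of generic order `Σ e_k m_k`, so its strict transform is `τᶜ(host, Σ e_k m_k)`, which §1–§2 factorise). [cite: Kollar2007, 3.30.2] -/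
theorem strictTransformIdeal_monomialIdeal (hW : Scheme.IsRegular W) (hC : Scheme.IsRegular C.subscheme)
    (hη : IsGenericPoint η (C.support : Set W)) (hint : interior (C.support : Set W) = ∅) (hτ : IsBlowup τ C)
    (Ps : List (W.IdealSheafData × ℕ)) (hcart : ∀ P ∈ boundaryOf Ps, IsEffectiveCartier P) :
    strictTransformIdeal τ C (monomialIdeal Ps) = monomialIdeal (Ps.map fun p => (strictTransformIdeal τ C p.1, p.2)) := by
  haveI : IsRegularLocalRing (W.presheaf.stalk η) := hW η
  -- read the generic orders of the factors off (they are finite: effective Cartier stalks are non-zero principal)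
  have hfin : ∀ P ∈ boundaryOf Ps, idealOrder P η ≠ ⊤ := fun P hP =>
    idealOrder_ne_top_of_isEffectiveCartier (hcart P hP)
  have hord : ∀ P ∈ boundaryOf Ps, idealOrder P η = (fun Q => (idealOrder Q η).toNat) P := fun P hP =>
    (ENat.coe_toNat (hfin P hP)).symm
  rw [hτ.strictTransformIdeal_eq_controlledTransform hW hC hη hint
      (idealOrder_monomialIdeal_genericPoint hW Ps _ hcart hord) (isEffectiveCartier_monomialIdeal hcart),
    controlledTransform_monomialIdeal_eq_map_strictTransform hW hC hη hint hτ Ps _ hcart hord]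

/-- **Each transported factor is an effective Cartier divisor** (`st P_k = τᶜ(P_k, m_k)`, tree
`IsBlowup.isEffectiveCartier_controlledTransform_of_le_pow`). [cite: Kollar2007, 3.30.2] -/
theorem isEffectiveCartier_strictTransformIdeal (hW : Scheme.IsRegular W) (hC : Scheme.IsRegular C.subscheme)
    (hη : IsGenericPoint η (C.support : Set W)) (hint : interior (C.support : Set W) = ∅) (hτ : IsBlowup τ C)
    {P : W.IdealSheafData} {n : ℕ} (hcart : IsEffectiveCartier P) (hord : idealOrder P η = n) :
    IsEffectiveCartier (strictTransformIdeal τ C P) := by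
  rw [hτ.strictTransformIdeal_eq_controlledTransform hW hC hη hint hord hcart]
  exact hτ.isEffectiveCartier_controlledTransform_of_le_pow hcart (le_pow_of_idealOrder_genericPoint_eq hW hC hη hord)

/-- Hence **every member of the transported boundary list is an effective Cartier divisor** — the factorisation invariant
one step up. [cite: Kollar2007, 3.30.2] -/
theorem isEffectiveCartier_of_mem_boundaryOf_map (hW : Scheme.IsRegular W) (hC : Scheme.IsRegular C.subscheme)
    (hη : IsGenericPoint η (C.support : Set W)) (hint : interior (C.support : Set W) = ∅) (hτ : IsBlowup τ C)
    (Ps : List (W.IdealSheafData × ℕ)) (m : W.IdealSheafData → ℕ) (hcart : ∀ P ∈ boundaryOf Ps, IsEffectiveCartier P)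
    (hord : ∀ P ∈ boundaryOf Ps, idealOrder P η = m P) :
    ∀ P' ∈ boundaryOf (Ps.map fun p => (strictTransformIdeal τ C p.1, p.2)), IsEffectiveCartier P' := by
  intro P' hP'
  rw [boundaryOf_map_pair, List.mem_map] at hP'
  obtain ⟨P, hP, rfl⟩ := hP'
  exact isEffectiveCartier_strictTransformIdeal hW hC hη hint hτ (hcart P hP) (hord P hP)

/-- **«NO EXCEPTIONAL COMPONENT»: the transported host `∏ (st P_k)^{e_k}` is not contained in the exceptional ideal
`C𝒪_{W′}`** (its weight `Σ e_k m_k` is the exact generic order of the host; tree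
`IsBlowup.not_controlledTransform_le_comap_of_idealOrder_genericPoint_eq'`) — the `¬ τᶜ(D′, m) ≤ C.comap τ` clause of
`IsWeightedSeqJR.cons`. [cite: Kollar2007, 3.30.2] -/
theorem not_monomialIdeal_map_strictTransform_le_comap (hW : Scheme.IsRegular W) (hC : Scheme.IsRegular C.subscheme)
    (hη : IsGenericPoint η (C.support : Set W)) (hint : interior (C.support : Set W) = ∅) (hτ : IsBlowup τ C)
    (Ps : List (W.IdealSheafData × ℕ)) (m : W.IdealSheafData → ℕ) (hcart : ∀ P ∈ boundaryOf Ps, IsEffectiveCartier P)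
    (hord : ∀ P ∈ boundaryOf Ps, idealOrder P η = m P) :
    ¬ monomialIdeal (Ps.map fun p => (strictTransformIdeal τ C p.1, p.2)) ≤ C.comap τ := by
  rw [← controlledTransform_monomialIdeal_eq_map_strictTransform hW hC hη hint hτ Ps m hcart hord]
  exact hτ.not_controlledTransform_le_comap_of_idealOrder_genericPoint_eq' hW hC hη hint
    (idealOrder_monomialIdeal_genericPoint hW Ps m hcart hord)

/-- **The host law with the weights READ OFF** as `m_k := (ord_η P_k).toNat` (all finite for effective Cartier factors):
`τᶜ(∏ P_k^{e_k}, Σ e_k (ord_η P_k).toNat) = ∏ (st P_k)^{e_k}`. [cite: Kollar2007, 3.30.2] -/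
theorem controlledTransform_monomialIdeal_eq_map_strictTransform_toNat (hW : Scheme.IsRegular W)
    (hC : Scheme.IsRegular C.subscheme) (hη : IsGenericPoint η (C.support : Set W))
    (hint : interior (C.support : Set W) = ∅) (hτ : IsBlowup τ C) (Ps : List (W.IdealSheafData × ℕ))
    (hcart : ∀ P ∈ boundaryOf Ps, IsEffectiveCartier P) (hfin : ∀ P ∈ boundaryOf Ps, idealOrder P η ≠ ⊤) :
    controlledTransform τ C (monomialIdeal Ps) (Ps.map fun p => p.2 * (idealOrder p.1 η).toNat).sum =
      monomialIdeal (Ps.map fun p => (strictTransformIdeal τ C p.1, p.2)) :=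
  controlledTransform_monomialIdeal_eq_map_strictTransform hW hC hη hint hτ Ps (fun P => (idealOrder P η).toNat) hcart
    fun P hP => (ENat.coe_toNat (hfin P hP)).symm

/-! ### The PIECE dress of `WeightTwoB.CentreIn`: `C = 𝓘(Z)`, `IsGenericPoint η Z` -/

/-- **The host law in the piece dress** of the T5-E transport (`C := vanishingIdeal Z` for an irreducible regular closed
piece `Z` with generic point `η`, lying on the host so that `Z` is nowhere dense):
`τᶜ(∏ P_k^{e_k}, Σ e_k m_k) = ∏ (st P_k)^{e_k}` along `τ = Bl_{𝓘(Z)}`. [cite: Kollar2007, 3.30.2] -/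
theorem controlledTransform_monomialIdeal_eq_map_strictTransform_piece (hW : Scheme.IsRegular W) {Z : Closeds W}
    (hZ : Scheme.IsRegular (vanishingIdeal Z).subscheme) (hη : IsGenericPoint η (Z : Set W))
    (hint : interior (Z : Set W) = ∅) (hτ : IsBlowup τ (vanishingIdeal Z)) (Ps : List (W.IdealSheafData × ℕ))
    (m : W.IdealSheafData → ℕ) (hcart : ∀ P ∈ boundaryOf Ps, IsEffectiveCartier P)
    (hord : ∀ P ∈ boundaryOf Ps, idealOrder P η = m P) :
    controlledTransform τ (vanishingIdeal Z) (monomialIdeal Ps) (Ps.map fun p => p.2 * m p.1).sum =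
      monomialIdeal (Ps.map fun p => (strictTransformIdeal τ (vanishingIdeal Z) p.1, p.2)) := by
  have hη' : IsGenericPoint η ((vanishingIdeal Z).support : Set W) := by
    rwa [Scheme.IdealSheafData.coe_support_vanishingIdeal]
  have hint' : interior ((vanishingIdeal Z).support : Set W) = ∅ := by
    rwa [Scheme.IdealSheafData.coe_support_vanishingIdeal]
  exact controlledTransform_monomialIdeal_eq_map_strictTransform hW hZ hη' hint' hτ Ps m hcart hord

/-- **The piece is nowhere dense as soon as it lies on one factor of the host** (`η ∈ V(P_k)` for some effective Cartier
`P_k`; tree `interior_eq_empty_of_isGenericPoint_of_mem_support`) — the `hint` binder in the T5-E^nr transport, where the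
centre lies on the host `Supp ∏ P_k^{e_k} = ⋃ V(P_k)`. [cite: GortzWedhorn2020, Remark 9.24] -/
theorem interior_eq_empty_of_mem_support_of_mem {S : Set W} (hη : IsGenericPoint η S) {Ps : List (W.IdealSheafData × ℕ)}
    (hcart : ∀ P ∈ boundaryOf Ps, IsEffectiveCartier P) {P : W.IdealSheafData} (hP : P ∈ boundaryOf Ps)
    (hηP : η ∈ P.support) : interior S = ∅ :=
  interior_eq_empty_of_isGenericPoint_of_mem_support hη (hcart P hP) hηP

end Blowup

end DepthHostLaw

end Summit.ResolutionOfSingularities.ResolutionOfSingularities.Theorems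

end
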